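import Literature.MathematicalPhysics.QuantumManyBody.JelliumExchangeBound
import HarnessLib

/-!
# Cauchy–Schwarz bounds for the mixed blocks of the pair term (Lieb–Solovej Lemma 5.6 mechanism)

Topic `Literature/MathematicalPhysics/QuantumManyBody` (the charged Bose gas, `JelliumBoseGas.foldyLaw`).
[LiebSolovej2001, Lemma 5.6]: the terms of `H^n_{ℓ,r,R}` with coefficients `ŵ_{pq,m0}` (three nonzero
indices) are bounded below by `-ε⁻¹4πℓ⁻³R² n̂₀n̂₊ - εn̂₊r⁻¹ - ε∑ŵ_{mp',pm'}a*a*aa`, by a Cauchy–Schwarz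
inequality in the positive structure `ŵ = ∑_α J^α ⊗ J^α`. In first quantization the blocks are
`2Re⟨QᵢQⱼΨ, w(xᵢ,xⱼ) QᵢPⱼΨ⟩` (`i ≠ j`) and, since the weight `w(xᵢ,xⱼ) ≥ 0` acts by
MULTIPLICATION, pointwise Cauchy–Schwarz suffices: for every `ε > 0`,

`2∫_{Λⁿ} w|F||G| ≤ ε∫_{Λⁿ} w|F|² + ε⁻¹∫_{Λⁿ} w|G|²`   (`two_lintegral_weight_mul_mul_le`),

and for `G` independent of `xⱼ` the last integral is at most `ℓ⁻³(sup_x∫_Λw(x,y)dy)‖G‖²`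
(`lintegral_weight_normSq_le_of_update_invariant`, the dummy integration of `JelliumLemma52.lean`).
With `F = QᵢQⱼΨ`, `G = QᵢPⱼΨ = PⱼQᵢΨ` this is the printed bound with `∑_{i≠j}‖PⱼQᵢΨ‖² = ⟨n̂₀n̂₊⟩`
and `∑_{i≠j}∫w|QᵢQⱼΨ|² ↔ ∑ŵ_{mp',pm'}a*a*aa` (`threeQ_blocks_le`).

## References

* [LiebSolovej2001] E. H. Lieb, J. P. Solovej, Commun. Math. Phys. 217 (2001) 127–163, Lemma 5.6
  (arXiv:cond-mat/0007425, p. 13).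
-/

noncomputable section

open MeasureTheory Set Filter Real
open scoped ENNReal NNReal Topology

namespace Literature.MathematicalPhysics.QuantumManyBody.JelliumBoseGas

open BoseGas

variable {n : ℕ} {ℓ : ℝ}

/-- **Pointwise Cauchy–Schwarz for a nonnegative weight**: for measurable `F, G` and a measurable
weight `W ≥ 0` on configuration space, `2∫W|F||G| ≤ ε∫W|F|² + ε⁻¹∫W|G|²` (`0 < ε < ∞`).
[cite: LiebSolovej2001, Lemma 5.6 (proof)] -/
theorem two_lintegral_weight_mul_mul_le {μ : Measure (Config n)} {W : Config n → ℝ≥0∞} (hW : Measurable W)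
    {F G : Config n → ℂ} (hF : Measurable F) (hG : Measurable G) {ε : ℝ≥0∞} (hε : ε ≠ 0) (hε' : ε ≠ ⊤) :
    2 * ∫⁻ X, W X * ((‖F X‖₊ : ℝ≥0∞) * ‖G X‖₊) ∂μ ≤
      ε * ∫⁻ X, W X * (‖F X‖₊ : ℝ≥0∞) ^ 2 ∂μ + ε⁻¹ * ∫⁻ X, W X * (‖G X‖₊ : ℝ≥0∞) ^ 2 ∂μ := by
  -- `2pq ≤ εp² + ε⁻¹q²` in `ℝ≥0∞` (cf. `ENNReal.two_mul_mul_le_eps` elsewhere in the tree)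
  have heps : ∀ p q : ℝ≥0∞, 2 * (p * q) ≤ ε * p ^ 2 + ε⁻¹ * q ^ 2 := by
    intro p q
    rcases eq_or_ne p ⊤ with rfl | hp
    · simp [hε]
    rcases eq_or_ne q ⊤ with rfl | hq
    · simp [ENNReal.inv_ne_zero.2 hε']
    lift p to ℝ≥0 using hp
    lift q to ℝ≥0 using hq
    have hε'' := hε'
    lift ε to ℝ≥0 using hε'' with e
    have hε0 : (e : ℝ≥0) ≠ 0 := by exact_mod_cast hε
    have hεpos : (0 : ℝ) < e := by positivity
    rw [← ENNReal.coe_inv hε0]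
    have h : (2 : ℝ≥0) * (p * q) ≤ e * p ^ 2 + e⁻¹ * q ^ 2 := by
      rw [← NNReal.coe_le_coe]
      push_cast
      have key : 0 ≤ e * ((p : ℝ) - (e : ℝ)⁻¹ * q) ^ 2 := by positivity
      have ex : (e : ℝ) * ((p : ℝ) - (e : ℝ)⁻¹ * q) ^ 2 =
          e * (p : ℝ) ^ 2 - 2 * (p * q) + (e : ℝ)⁻¹ * (q : ℝ) ^ 2 := by
        field_simp
        ring
      linarith [key, ex]
    exact_mod_cast h
  have hm : Measurable fun X => W X * ((‖F X‖₊ : ℝ≥0∞) * ‖G X‖₊) :=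
    hW.mul (hF.nnnorm.coe_nnreal_ennreal.mul hG.nnnorm.coe_nnreal_ennreal)
  have hmF : Measurable fun X => W X * (‖F X‖₊ : ℝ≥0∞) ^ 2 := hW.mul (hF.nnnorm.coe_nnreal_ennreal.pow_const _)
  have hmG : Measurable fun X => W X * (‖G X‖₊ : ℝ≥0∞) ^ 2 := hW.mul (hG.nnnorm.coe_nnreal_ennreal.pow_const _)
  have hmF' : Measurable fun X => ε * (W X * (‖F X‖₊ : ℝ≥0∞) ^ 2) := hmF.const_mul _
  calc 2 * ∫⁻ X, W X * ((‖F X‖₊ : ℝ≥0∞) * ‖G X‖₊) ∂μ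
      = ∫⁻ X, 2 * (W X * ((‖F X‖₊ : ℝ≥0∞) * ‖G X‖₊)) ∂μ := by rw [lintegral_const_mul _ hm]
    _ ≤ ∫⁻ X, (ε * (W X * (‖F X‖₊ : ℝ≥0∞) ^ 2) + ε⁻¹ * (W X * (‖G X‖₊ : ℝ≥0∞) ^ 2)) ∂μ := by
        refine lintegral_mono fun X => ?_
        calc 2 * (W X * ((‖F X‖₊ : ℝ≥0∞) * ‖G X‖₊)) = W X * (2 * ((‖F X‖₊ : ℝ≥0∞) * ‖G X‖₊)) := by ring
          _ ≤ W X * (ε * (‖F X‖₊ : ℝ≥0∞) ^ 2 + ε⁻¹ * (‖G X‖₊ : ℝ≥0∞) ^ 2) := by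
              gcongr; exact heps _ _
          _ = _ := by ring
    _ = ε * ∫⁻ X, W X * (‖F X‖₊ : ℝ≥0∞) ^ 2 ∂μ + ε⁻¹ * ∫⁻ X, W X * (‖G X‖₊ : ℝ≥0∞) ^ 2 ∂μ := by
        rw [lintegral_add_left hmF', lintegral_const_mul _ hmF, lintegral_const_mul _ hmG]

/-- **Dummy integration bound**: for `i ≠ j`, a jointly measurable kernel `w ≥ 0` with
`∫_Λ w(x,y)dy ≤ M` for all `x`, and a continuous `G` independent of `xⱼ` (`ℓ > 0`),
`∫_{Λⁿ} w(xᵢ,xⱼ)|G|² ≤ ℓ⁻³M‖G‖²`. [cite: LiebSolovej2001, Lemma 5.6 (proof)] -/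
theorem lintegral_weight_normSq_le_of_update_invariant (hℓ : 0 < ℓ) {i j : Fin n} (hij : i ≠ j)
    {w : Space → Space → ℝ≥0∞} (hw : Measurable (Function.uncurry w)) {M : ℝ≥0∞}
    (h1 : ∀ x, ∫⁻ y in cell ℓ, w x y ≤ M) {G : Config n → ℂ} (hG : Continuous G)
    (hGj : ∀ X z, G (Function.update X j z) = G X) :
    ∫⁻ X in cellN n ℓ, w (X i) (X j) * (‖G X‖₊ : ℝ≥0∞) ^ 2 ≤
      (ENNReal.ofReal ℓ ^ 3)⁻¹ * M * ∫⁻ X in cellN n ℓ, (‖G X‖₊ : ℝ≥0∞) ^ 2 := by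
  have hgF : Measurable (Function.uncurry fun (X : Config n) (y : Space) => w (X i) y) := by
    have e : (Function.uncurry fun (X : Config n) (y : Space) => w (X i) y) =
        Function.uncurry w ∘ fun p : Config n × Space => (p.1 i, p.2) := rfl
    rw [e]; exact hw.comp (by fun_prop)
  rw [lintegral_cellN_weight_of_update_invariant hℓ j (g := fun X y => w (X i) y) hgF
    (fun X y z => by simp only [Function.update_of_ne hij]) hG.measurable hGj, mul_assoc,
    ← lintegral_const_mul _ (hG.measurable.nnnorm.coe_nnreal_ennreal.pow_const _)]
  gcongr with X
  exact h1 _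

/-- **The three-`Q` blocks** [LiebSolovej2001, Lemma 5.6], first-quantized expectation form: for
continuous `Ψ`, `ℓ > 0`, `0 < ε < ∞`, and a jointly measurable kernel `w ≥ 0` with `∫_Λw(x,y)dy ≤ M`
for all `x`,
`2∑_{i≠j}∫_{Λⁿ} w(xᵢ,xⱼ)|QⱼQᵢΨ||PⱼQᵢΨ| ≤ ε∑_{i≠j}∫_{Λⁿ}w(xᵢ,xⱼ)|QⱼQᵢΨ|² + ε⁻¹ℓ⁻³M∑_{i≠j}‖PⱼQᵢΨ‖²`
(`∑_{i≠j}‖PⱼQᵢΨ‖² = ⟨n̂₀n̂₊⟩`; with `M = 4πR²` the printed `-ε⁻¹4πℓ⁻³R²n̂₀n̂₊ - ε∑ŵ_{mp',pm'}a*a*aa`).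
[cite: LiebSolovej2001, Lemma 5.6] -/
theorem threeQ_blocks_le (hℓ : 0 < ℓ) {w : Space → Space → ℝ≥0∞} (hw : Measurable (Function.uncurry w))
    {M : ℝ≥0∞} (h1 : ∀ x, ∫⁻ y in cell ℓ, w x y ≤ M) {Ψ : Config n → ℂ} (hΨ : Continuous Ψ)
    {ε : ℝ≥0∞} (hε : ε ≠ 0) (hε' : ε ≠ ⊤) :
    2 * (∑ i : Fin n, ∑ j ∈ Finset.univ.erase i, ∫⁻ X in cellN n ℓ, w (X i) (X j) *
        ((‖sliceFluct ℓ j (sliceFluct ℓ i Ψ) X‖₊ : ℝ≥0∞) * ‖sliceMean ℓ j (sliceFluct ℓ i Ψ) X‖₊)) ≤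
      ε * (∑ i : Fin n, ∑ j ∈ Finset.univ.erase i, ∫⁻ X in cellN n ℓ, w (X i) (X j) *
          (‖sliceFluct ℓ j (sliceFluct ℓ i Ψ) X‖₊ : ℝ≥0∞) ^ 2) +
        ε⁻¹ * ((ENNReal.ofReal ℓ ^ 3)⁻¹ * M) * (∑ i : Fin n, ∑ j ∈ Finset.univ.erase i,
          ∫⁻ X in cellN n ℓ, (‖sliceMean ℓ j (sliceFluct ℓ i Ψ) X‖₊ : ℝ≥0∞) ^ 2) := by
  have hwij : ∀ i j : Fin n, Measurable fun X : Config n => w (X i) (X j) := by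
    intro i j
    have e : (fun X : Config n => w (X i) (X j)) = Function.uncurry w ∘ fun X : Config n => (X i, X j) := rfl
    rw [e]; exact hw.comp (by fun_prop)
  rw [Finset.mul_sum, Finset.mul_sum, Finset.mul_sum, ← Finset.sum_add_distrib]
  refine Finset.sum_le_sum fun i _ => ?_
  rw [Finset.mul_sum, Finset.mul_sum, Finset.mul_sum, ← Finset.sum_add_distrib]
  refine Finset.sum_le_sum fun j hj => ?_
  have hij : i ≠ j := (Finset.ne_of_mem_erase hj).symm
  have hFc : Continuous (sliceFluct ℓ j (sliceFluct ℓ i Ψ)) :=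
    continuous_sliceFluct ℓ j (continuous_sliceFluct ℓ i hΨ)
  have hGc : Continuous (sliceMean ℓ j (sliceFluct ℓ i Ψ)) :=
    continuous_sliceMean ℓ j (continuous_sliceFluct ℓ i hΨ)
  have hcs := two_lintegral_weight_mul_mul_le (μ := volume.restrict (cellN n ℓ)) (hwij i j)
    hFc.measurable hGc.measurable hε hε'
  have hdum := lintegral_weight_normSq_le_of_update_invariant hℓ hij hw h1 hGc
    (fun X z => sliceMean_update ℓ j _ X z)
  calc _ ≤ _ := hcs
    _ ≤ _ := by rw [mul_assoc ε⁻¹]; gcongr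

end Literature.MathematicalPhysics.QuantumManyBody.JelliumBoseGas
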